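import Summits.KontsevichZagierPeriods.KontsevichZagierPeriods.Theorems.LinRedNormalFormWheelThreeSpokesCharts

/-!
# `WheelThreeSpokes` (stmt-KontsevichZagierPeriods-3913), line `laplacian-ldl-chart`:
the doubling `[D4, g₄] ≡ 2·[P2, g₄]` (`stub_doubling`)

After the Newton–Leibniz descent `5 → 4` the chain sits on
`D4 = {0<u, 0<v, u+v<1, uv < w d₂, u(1−u−v) < d₂(1−w)}` (coordinates `p = (u,v,w,d₂)`) with the
integrand `g₄ = 1/(d₂(v(1−u−v) + w(1−w)d₂))`. The affine involution
`ι(u,v,w,d₂) = (u, 1−u−v, 1−w, d₂)` (polynomial, `|det| = 1`) preserves `g₄` and `D4` and swaps the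
two regimes

* `P2 = {0<u, 0<v, u+v<1, v < w(1−u), w < 1, u(1−u−v) < d₂(1−w)}`,
* `P1 = {0<u, 0<v, u+v<1, w(1−u) < v, 0 < w, uv < w d₂}`,

and `D4 = P1 ⊔ P2 ⊔ (D4 ∩ {w(1−u) = v})`, the wall being Lebesgue-null. Hence (this file):
domain additivity (rule (1a)) after shaving the null wall, and ONE change of variables along `ι`
(rule (2), `BeukersZeta3.polyChart_transport`) identifying `[P1, g₄]` with `[P2, g₄]`, give
`[D4, g₄] ≡ 2·[P2, g₄]` modulo `KZ.relations`; and the `D4` representation exists as soon as the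
`P2` one does (absolute integrability on `P1` is transported along `ι`, the wall is null).
Pattern of `LinRedNormalFormBeukersZeta3.lean` (`[I₁] ≡ 2[A]`, dimension three).

References: M. Kontsevich, D. Zagier, *Periods* (2001), §1.2 rules (1), (2).
-/

noncomputable section

open Set MeasureTheory MvPolynomial
open Literature.NumberTheory.Transcendental
open Literature.ModelTheory.ExponentialFields (IsSemialgebraic isSemialgebraic_setOf_eval_lt)

namespace Summit.KontsevichZagierPeriods.LinRedNormalForm.WheelThreeSpokes

/-! ### The sets, the integrand and the chart (local notations) -/

local notation "D4set" => setOf (fun p : Fin 4 → ℝ => 0 < p 0 ∧ 0 < p 1 ∧ p 0 + p 1 < 1 ∧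
  p 0 * p 1 < p 2 * p 3 ∧ p 0 * (1 - p 0 - p 1) < p 3 * (1 - p 2))
local notation "P2set" => setOf (fun p : Fin 4 → ℝ => 0 < p 0 ∧ 0 < p 1 ∧ p 0 + p 1 < 1 ∧
  p 1 < p 2 * (1 - p 0) ∧ p 2 < 1 ∧ p 0 * (1 - p 0 - p 1) < p 3 * (1 - p 2))
local notation "P1set" => setOf (fun p : Fin 4 → ℝ => 0 < p 0 ∧ 0 < p 1 ∧ p 0 + p 1 < 1 ∧
  p 2 * (1 - p 0) < p 1 ∧ 0 < p 2 ∧ p 0 * p 1 < p 2 * p 3)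
local notation "g4" =>
  (fun p : Fin 4 → ℝ => 1 / (p 3 * (p 1 * (1 - p 0 - p 1) + p 2 * (1 - p 2) * p 3)))
local notation "Pι" => (![X 0, 1 - X 0 - X 1, 1 - X 2, X 3] : Fin 4 → MvPolynomial (Fin 4) ℚ)

namespace Doubling

/-! ### Semialgebraic sets cut out by five or six strict polynomial inequalities -/

/-- A conjunction of five strict polynomial inequalities cuts out a `ℚ`-semialgebraic set.
[folklore] -/
theorem isSemialgebraic_setOf_five_lt {N : ℕ}
    (p₁ q₁ p₂ q₂ p₃ q₃ p₄ q₄ p₅ q₅ : MvPolynomial (Fin N) ℚ) :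
    IsSemialgebraic ℚ {x : Fin N → ℝ | aeval x p₁ < aeval x q₁ ∧ aeval x p₂ < aeval x q₂ ∧
      aeval x p₃ < aeval x q₃ ∧ aeval x p₄ < aeval x q₄ ∧ aeval x p₅ < aeval x q₅} := by
  have h := ((((isSemialgebraic_setOf_eval_lt (R := ℝ) p₁ q₁).inter
    (isSemialgebraic_setOf_eval_lt p₂ q₂)).inter (isSemialgebraic_setOf_eval_lt p₃ q₃)).inter
    (isSemialgebraic_setOf_eval_lt p₄ q₄)).inter (isSemialgebraic_setOf_eval_lt p₅ q₅)
  have hset : {x : Fin N → ℝ | aeval x p₁ < aeval x q₁ ∧ aeval x p₂ < aeval x q₂ ∧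
      aeval x p₃ < aeval x q₃ ∧ aeval x p₄ < aeval x q₄ ∧ aeval x p₅ < aeval x q₅} =
      {x : Fin N → ℝ | aeval x p₁ < aeval x q₁} ∩ {x | aeval x p₂ < aeval x q₂} ∩
      {x | aeval x p₃ < aeval x q₃} ∩ {x | aeval x p₄ < aeval x q₄} ∩
      {x | aeval x p₅ < aeval x q₅} := by
    ext x
    simp only [mem_setOf_eq, mem_inter_iff, and_assoc]
  rw [hset]
  exact h

/-- A conjunction of six strict polynomial inequalities cuts out a `ℚ`-semialgebraic set.
[folklore] -/
theorem isSemialgebraic_setOf_six_lt {N : ℕ}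
    (p₁ q₁ p₂ q₂ p₃ q₃ p₄ q₄ p₅ q₅ p₆ q₆ : MvPolynomial (Fin N) ℚ) :
    IsSemialgebraic ℚ {x : Fin N → ℝ | aeval x p₁ < aeval x q₁ ∧ aeval x p₂ < aeval x q₂ ∧
      aeval x p₃ < aeval x q₃ ∧ aeval x p₄ < aeval x q₄ ∧ aeval x p₅ < aeval x q₅ ∧
      aeval x p₆ < aeval x q₆} := by
  have h := (((((isSemialgebraic_setOf_eval_lt (R := ℝ) p₁ q₁).inter
    (isSemialgebraic_setOf_eval_lt p₂ q₂)).inter (isSemialgebraic_setOf_eval_lt p₃ q₃)).inter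
    (isSemialgebraic_setOf_eval_lt p₄ q₄)).inter (isSemialgebraic_setOf_eval_lt p₅ q₅)).inter
    (isSemialgebraic_setOf_eval_lt p₆ q₆)
  have hset : {x : Fin N → ℝ | aeval x p₁ < aeval x q₁ ∧ aeval x p₂ < aeval x q₂ ∧
      aeval x p₃ < aeval x q₃ ∧ aeval x p₄ < aeval x q₄ ∧ aeval x p₅ < aeval x q₅ ∧
      aeval x p₆ < aeval x q₆} =
      {x : Fin N → ℝ | aeval x p₁ < aeval x q₁} ∩ {x | aeval x p₂ < aeval x q₂} ∩
      {x | aeval x p₃ < aeval x q₃} ∩ {x | aeval x p₄ < aeval x q₄} ∩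
      {x | aeval x p₅ < aeval x q₅} ∩ {x | aeval x p₆ < aeval x q₆} := by
    ext x
    simp only [mem_setOf_eq, mem_inter_iff, and_assoc]
  rw [hset]
  exact h

/-! ### The three domains -/

/-- `D4` is `ℚ`-semialgebraic. [folklore] -/
theorem isSemialgebraic_D4 : IsSemialgebraic ℚ D4set := by
  have h := isSemialgebraic_setOf_five_lt (N := 4) 0 (X 0) 0 (X 1) (X 0 + X 1) 1 (X 0 * X 1)
    (X 2 * X 3) (X 0 * (1 - X 0 - X 1)) (X 3 * (1 - X 2))
  simp only [map_zero, map_one, map_add, map_mul, map_sub, aeval_X] at h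
  exact h

/-- `P2` is `ℚ`-semialgebraic. [folklore] -/
theorem isSemialgebraic_P2 : IsSemialgebraic ℚ P2set := by
  have h := isSemialgebraic_setOf_six_lt (N := 4) 0 (X 0) 0 (X 1) (X 0 + X 1) 1 (X 1)
    (X 2 * (1 - X 0)) (X 2) 1 (X 0 * (1 - X 0 - X 1)) (X 3 * (1 - X 2))
  simp only [map_zero, map_one, map_add, map_mul, map_sub, aeval_X] at h
  exact h

/-- `P1` is `ℚ`-semialgebraic. [folklore] -/
theorem isSemialgebraic_P1 : IsSemialgebraic ℚ P1set := by
  have h := isSemialgebraic_setOf_six_lt (N := 4) 0 (X 0) 0 (X 1) (X 0 + X 1) 1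
    (X 2 * (1 - X 0)) (X 1) 0 (X 2) (X 0 * X 1) (X 2 * X 3)
  simp only [map_zero, map_one, map_add, map_mul, map_sub, aeval_X] at h
  exact h

/-- On `D4` one has `d₂ > 0` and `0 < w < 1` (from `uv > 0`, `u(1−u−v) > 0`). [folklore] -/
theorem pos_of_mem_D4 {p : Fin 4 → ℝ} (hp : p ∈ D4set) : 0 < p 3 ∧ 0 < p 2 ∧ p 2 < 1 := by
  obtain ⟨h0, h1, h2, h3, h4⟩ := hp
  have hwd : 0 < p 2 * p 3 := lt_trans (mul_pos h0 h1) h3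
  have hdw : 0 < p 3 * (1 - p 2) := lt_trans (mul_pos h0 (by linarith)) h4
  have hd : 0 < p 3 := by linarith
  have hw : 0 < p 2 := by
    by_contra hcon
    push Not at hcon
    nlinarith
  have hw1 : 0 < 1 - p 2 := by
    by_contra hcon
    push Not at hcon
    nlinarith
  exact ⟨hd, hw, by linarith⟩

/-- `P2 ⊆ D4`. [folklore] -/
theorem P2_subset_D4 : P2set ⊆ D4set := by
  rintro p ⟨h0, h1, h2, h3, h4, h5⟩
  refine ⟨h0, h1, h2, ?_, h5⟩
  -- `(1 − w)·uv < (1 − w)·w d₂` from `w·u(1−u−v) < w·d₂(1−w)` and `u·v < u·w(1−u)`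
  have hw : 0 < p 2 := by
    by_contra hcon
    push Not at hcon
    nlinarith
  have hA : p 2 * (p 0 * (1 - p 0 - p 1)) < p 2 * (p 3 * (1 - p 2)) := mul_lt_mul_of_pos_left h5 hw
  have hB : p 0 * p 1 < p 0 * (p 2 * (1 - p 0)) := mul_lt_mul_of_pos_left h3 h0
  have hC : (1 - p 2) * (p 0 * p 1) < (1 - p 2) * (p 2 * p 3) := by linarith
  exact lt_of_mul_lt_mul_left hC (sub_pos.2 h4).le

/-- `P1 ⊆ D4`. [folklore] -/
theorem P1_subset_D4 : P1set ⊆ D4set := by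
  rintro p ⟨h0, h1, h2, h3, h4, h5⟩
  refine ⟨h0, h1, h2, h5, ?_⟩
  -- `w < 1` since `w(1−u) < v < 1 − u`
  have hw1 : 0 < 1 - p 2 := by
    by_contra hcon
    push Not at hcon
    nlinarith
  have hA : (1 - p 2) * (p 0 * p 1) < (1 - p 2) * (p 2 * p 3) := mul_lt_mul_of_pos_left h5 hw1
  have hB : p 0 * (p 2 * (1 - p 0)) < p 0 * p 1 := mul_lt_mul_of_pos_left h3 h0
  have hC : p 2 * (p 0 * (1 - p 0 - p 1)) < p 2 * (p 3 * (1 - p 2)) := by linarith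
  exact lt_of_mul_lt_mul_left hC h4.le

/-- `P1 ∩ P2 = ∅` (the two regimes of the wall `w(1−u) = v`). [folklore] -/
theorem P1_inter_P2 : P1set ∩ P2set = ∅ := by
  ext p
  simp only [mem_inter_iff, mem_setOf_eq, mem_empty_iff_false, iff_false]
  rintro ⟨⟨-, -, -, h, -, -⟩, ⟨-, -, -, h', -, -⟩⟩
  exact lt_asymm h h'

/-- Off `P1 ∪ P2`, a point of `D4` lies on the wall `w(1−u) = v`. [folklore] -/
theorem D4_diff_subset_wall : D4set \ (P1set ∪ P2set) ⊆
    {z : Fin 4 → ℝ | aeval z (X 2 * (1 - X 0) : MvPolynomial (Fin 4) ℚ) =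
      aeval z (X 1 : MvPolynomial (Fin 4) ℚ)} := by
  intro p hp
  obtain ⟨hpD, hpn⟩ := hp
  obtain ⟨hd, hw, hw1⟩ := pos_of_mem_D4 hpD
  obtain ⟨h0, h1, h2, h3, h4⟩ := hpD
  simp only [mem_union, mem_setOf_eq, not_or] at hpn
  obtain ⟨hn1, hn2⟩ := hpn
  simp only [mem_setOf_eq, map_mul, map_sub, map_one, aeval_X]
  rcases lt_trichotomy (p 2 * (1 - p 0)) (p 1) with hlt | heq | hgt
  · exact (hn1 ⟨h0, h1, h2, hlt, hw, h3⟩).elim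
  · exact heq
  · exact (hn2 ⟨h0, h1, h2, hgt, hw1, h4⟩).elim

/-- The wall `w(1−u) = v` is Lebesgue-null. [folklore] -/
theorem volume_wall :
    volume {z : Fin 4 → ℝ | aeval z (X 2 * (1 - X 0) : MvPolynomial (Fin 4) ℚ) =
      aeval z (X 1 : MvPolynomial (Fin 4) ℚ)} = 0 :=
  ArrangementNormalForm.JanusBands.IntegrateOutLow.volume_setOf_aeval_eq _ _ (fun _ => 1)
    (by norm_num)

/-- The integrand `g₄ = 1/(d₂(v(1−u−v) + w(1−w)d₂))` is a `ℚ`-semialgebraic function on `D4`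
(non-vanishing denominator). [cite: BochnakCosteRoy1998, §2.2] -/
theorem isSemialgebraicFunOn_g4 : IsSemialgebraicFunOn ℚ D4set g4 := by
  refine (isSemialgebraicFunOn_aeval_div_aeval isSemialgebraic_D4 (1 : MvPolynomial (Fin 4) ℚ)
    (X 3 * (X 1 * (1 - X 0 - X 1) + X 2 * (1 - X 2) * X 3)) ?_).congr ?_
  · intro p hp
    obtain ⟨hd, hw, hw1⟩ := pos_of_mem_D4 hp
    obtain ⟨h0, h1, h2, -, -⟩ := hp
    have : 0 < 1 - p 0 - p 1 := by linarith
    have : 0 < 1 - p 2 := by linarith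
    simp only [map_mul, map_add, map_sub, map_one, aeval_X]
    positivity
  · intro p _
    simp

/-! ### The involution `ι(u,v,w,d₂) = (u, 1−u−v, 1−w, d₂)` -/

/-- Values of `ι`. [folklore] -/
theorem iota_apply (x : Fin 4 → ℝ) :
    (fun i => aeval x (Pι i)) = ![x 0, 1 - x 0 - x 1, 1 - x 2, x 3] := by
  funext i; fin_cases i <;> simp

/-- The Jacobian matrix of `ι` (lower triangular, diagonal `(1, −1, −1, 1)`). [folklore] -/
theorem jacobian_iota (y : Fin 4 → ℝ) :
    (Matrix.of fun i j => aeval y (pderiv j (Pι i)) : Matrix (Fin 4) (Fin 4) ℝ) =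
      !![1, 0, 0, 0; -1, -1, 0, 0; 0, 0, -1, 0; 0, 0, 0, 1] := by
  ext i j
  fin_cases i <;> fin_cases j <;> simp

/-- Jacobian determinant of `ι`: `1`. [folklore] -/
theorem det_iota (y : Fin 4 → ℝ) :
    (Matrix.of fun i j => aeval y (pderiv j (Pι i)) : Matrix (Fin 4) (Fin 4) ℝ).det
      = aeval y (1 : MvPolynomial (Fin 4) ℚ) := by
  rw [jacobian_iota, map_one]
  simp [Matrix.det_succ_row_zero, Fin.sum_univ_succ]

/-- `ι` is injective (on `P2`). [folklore] -/
theorem injOn_iota : InjOn (fun (x : Fin 4 → ℝ) (i : Fin 4) => aeval x (Pι i)) P2set := by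
  intro x _ x' _ h
  have h0 : aeval x (Pι 0) = aeval x' (Pι 0) := congrFun h 0
  have h1 : aeval x (Pι 1) = aeval x' (Pι 1) := congrFun h 1
  have h2 : aeval x (Pι 2) = aeval x' (Pι 2) := congrFun h 2
  have h3 : aeval x (Pι 3) = aeval x' (Pι 3) := congrFun h 3
  simp only [Matrix.cons_val, map_sub, map_one, aeval_X] at h0 h1 h2 h3
  funext i
  fin_cases i
  · exact h0
  · show x 1 = x' 1; linarith
  · show x 2 = x' 2; linarith
  · exact h3

/-- `ι` maps `P2` onto `P1` (it is an involution swapping the two regimes). [folklore] -/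
theorem image_iota : (fun (x : Fin 4 → ℝ) (i : Fin 4) => aeval x (Pι i)) '' P2set = P1set := by
  ext t
  simp only [mem_image, mem_setOf_eq, iota_apply]
  constructor
  · rintro ⟨x, ⟨h0, h1, h2, h3, h4, h5⟩, rfl⟩
    simp only [Matrix.cons_val]
    refine ⟨h0, by linarith, by linarith, by linarith, by linarith, by linarith⟩
  · rintro ⟨h0, h1, h2, h3, h4, h5⟩
    refine ⟨![t 0, 1 - t 0 - t 1, 1 - t 2, t 3], ?_, ?_⟩
    · simp only [Matrix.cons_val]
      refine ⟨h0, by linarith, by linarith, by linarith, by linarith, by linarith⟩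
    · funext i
      fin_cases i <;> simp

/-- Pull-back identity for `ι`: the integrand `g₄` is preserved (Jacobian `|1|`). [folklore] -/
theorem hgh_iota : ∀ y ∈ P2set, g4 y = g4 (fun i => aeval y (Pι i)) *
    |aeval y (1 : MvPolynomial (Fin 4) ℚ)| := by
  intro y _
  rw [iota_apply]
  simp only [Matrix.cons_val, map_one, abs_one, mul_one]
  ring

end Doubling

open Doubling in
/-- **stub_doubling**: `[D4, g₄] ≡ 2·[P2, g₄]` modulo the Kontsevich–Zagier moves — domain
additivity of `D4` along the null wall `w(1−u) = v` into the two regimes `P1`, `P2` (rule (1a)),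
and one change of variables along the affine involution `ι(u,v,w,d₂) = (u, 1−u−v, 1−w, d₂)`
(rule (2), polynomial, `|det| = 1`, preserving `g₄`, `ι(P2) = P1`) identifying `[P1, g₄]` with
`[P2, g₄]` — together with the existence of the `D4` representation from the `P2` one (absolute
integrability on `P1` transported along `ι`, the wall null).
[cite: KontsevichZagier2001, §1.2 rules (1), (2)] -/
theorem stub_doubling :
    (∀ p : KZ.IntegralRep 4, p.domain = {p : Fin 4 → ℝ | 0 < p 0 ∧ 0 < p 1 ∧ p 0 + p 1 < 1 ∧ p 1 < p 2 * (1 - p 0) ∧ p 2 < 1 ∧ p 0 * (1 - p 0 - p 1) < p 3 * (1 - p 2)} →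
      Set.EqOn p.integrand (fun p => 1 / (p 3 * (p 1 * (1 - p 0 - p 1) + p 2 * (1 - p 2) * p 3))) p.domain →
      ∃ r₄ : KZ.IntegralRep 4, r₄.domain = {p : Fin 4 → ℝ | 0 < p 0 ∧ 0 < p 1 ∧ p 0 + p 1 < 1 ∧ p 0 * p 1 < p 2 * p 3 ∧ p 0 * (1 - p 0 - p 1) < p 3 * (1 - p 2)} ∧
        r₄.integrand = fun p => 1 / (p 3 * (p 1 * (1 - p 0 - p 1) + p 2 * (1 - p 2) * p 3))) ∧
    (∀ r₄ p : KZ.IntegralRep 4, r₄.domain = {p : Fin 4 → ℝ | 0 < p 0 ∧ 0 < p 1 ∧ p 0 + p 1 < 1 ∧ p 0 * p 1 < p 2 * p 3 ∧ p 0 * (1 - p 0 - p 1) < p 3 * (1 - p 2)} →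
      Set.EqOn r₄.integrand (fun p => 1 / (p 3 * (p 1 * (1 - p 0 - p 1) + p 2 * (1 - p 2) * p 3))) r₄.domain →
      p.domain = {p : Fin 4 → ℝ | 0 < p 0 ∧ 0 < p 1 ∧ p 0 + p 1 < 1 ∧ p 1 < p 2 * (1 - p 0) ∧ p 2 < 1 ∧ p 0 * (1 - p 0 - p 1) < p 3 * (1 - p 2)} →
      Set.EqOn p.integrand (fun p => 1 / (p 3 * (p 1 * (1 - p 0 - p 1) + p 2 * (1 - p 2) * p 3))) p.domain →
      KZ.of r₄ - 2 • KZ.of p ∈ KZ.relations) := by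
  -- the transport package of the chart `ι : P2 → P1` (rule 2)
  have T := BeukersZeta3.polyChart_transport Pι 1 isSemialgebraic_P2 (fun y _ => det_iota y)
    injOn_iota g4 g4 hgh_iota
  rw [image_iota] at T
  have hnull : volume (D4set \ (P1set ∪ P2set)) = 0 :=
    measure_mono_null D4_diff_subset_wall volume_wall
  have hsub : P1set ∪ P2set ⊆ D4set := union_subset P1_subset_D4 P2_subset_D4
  refine ⟨fun p hpd hpi => ?_, fun r₄ p hr₄d hr₄i hpd hpi => ?_⟩
  · -- existence of the `D4` representation
    have hpi' : EqOn p.integrand g4 P2set := fun x hx => hpi (by rw [hpd]; exact hx)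
    have hi1 : IntegrableOn g4 P1set := T.2.1 p hpd hpi'
    have hi2 : IntegrableOn g4 P2set := by
      have := p.integrableOn.congr_fun hpi (KZ.IntegralRep.measurableSet_domain_holds p)
      rwa [hpd] at this
    have hiN : IntegrableOn g4 (D4set \ (P1set ∪ P2set)) := by
      rw [IntegrableOn, Measure.restrict_eq_zero.mpr hnull]
      exact integrable_zero_measure
    have hint : IntegrableOn g4 D4set := by
      refine ((hi1.union hi2).union hiN).mono_set ?_
      intro z hz
      by_cases h : z ∈ P1set ∪ P2set
      · exact Or.inl h
      · exact Or.inr ⟨hz, h⟩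
    exact ⟨⟨D4set, g4, isSemialgebraic_D4, isSemialgebraicFunOn_g4, hint⟩, rfl, rfl⟩
  · -- the move `[r₄] ≡ 2·[p]`
    have hUsa : IsSemialgebraic ℚ (P1set ∪ P2set) := isSemialgebraic_P1.union isSemialgebraic_P2
    have hUsub : P1set ∪ P2set ⊆ r₄.domain := by rw [hr₄d]; exact hsub
    have h1sub : P1set ⊆ r₄.domain := fun z hz => hUsub (Or.inl hz)
    have h2sub : P2set ⊆ r₄.domain := fun z hz => hUsub (Or.inr hz)
    -- shave the null wall
    have e1 : KZ.of r₄ - KZ.of (r₄.restrict _ hUsa hUsub) ∈ KZ.relations := by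
      refine r₄.of_sub_of_restrict_mem_relations hUsa hUsub ?_
      rw [hr₄d]
      exact hnull
    -- split the two regimes
    have e2 : KZ.of (r₄.restrict _ hUsa hUsub) - KZ.of (r₄.restrict _ isSemialgebraic_P1 h1sub) -
        KZ.of (r₄.restrict _ isSemialgebraic_P2 h2sub) ∈ KZ.relations := by
      refine KZ.domainAddRel_subset_relations ⟨4, r₄.restrict _ hUsa hUsub,
        r₄.restrict _ isSemialgebraic_P1 h1sub, r₄.restrict _ isSemialgebraic_P2 h2sub, rfl, ?_,
        fun _ _ => rfl, fun _ _ => rfl, rfl⟩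
      rw [KZ.IntegralRep.domain_restrict, KZ.IntegralRep.domain_restrict, P1_inter_P2,
        measure_empty]
    -- the change of variables `[P2] ~ [P1]` along `ι`
    have hg2 : EqOn (r₄.restrict _ isSemialgebraic_P2 h2sub).integrand g4 P2set :=
      fun z hz => hr₄i (h2sub hz)
    have hg1 : EqOn (r₄.restrict _ isSemialgebraic_P1 h1sub).integrand g4
        (r₄.restrict _ isSemialgebraic_P1 h1sub).domain := fun z hz => hr₄i (h1sub hz)
    have e3 : KZ.of (r₄.restrict _ isSemialgebraic_P2 h2sub) -
        KZ.of (r₄.restrict _ isSemialgebraic_P1 h1sub) ∈ KZ.relations :=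
      T.2.2 _ _ rfl hg2 rfl hg1
    -- `[r₄|P2] ≡ [p]` (same domain, integrands agree there)
    have e4 : KZ.of (r₄.restrict _ isSemialgebraic_P2 h2sub) - KZ.of p ∈ KZ.relations := by
      refine KZ.of_sub_of_mem_relations_of_eqOn hpd fun z hz => ?_
      rw [KZ.IntegralRep.integrand_restrict, hr₄i (h2sub hz), hpi (by rw [hpd]; exact hz)]
    have key : KZ.of r₄ - 2 • KZ.of p = (KZ.of r₄ - KZ.of (r₄.restrict _ hUsa hUsub)) +
        (KZ.of (r₄.restrict _ hUsa hUsub) - KZ.of (r₄.restrict _ isSemialgebraic_P1 h1sub) -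
          KZ.of (r₄.restrict _ isSemialgebraic_P2 h2sub)) -
        (KZ.of (r₄.restrict _ isSemialgebraic_P2 h2sub) -
          KZ.of (r₄.restrict _ isSemialgebraic_P1 h1sub)) +
        (KZ.of (r₄.restrict _ isSemialgebraic_P2 h2sub) - KZ.of p) +
        (KZ.of (r₄.restrict _ isSemialgebraic_P2 h2sub) - KZ.of p) := by
      abel
    rw [key]
    exact KZ.relations.add_mem (KZ.relations.add_mem (KZ.relations.sub_mem
      (KZ.relations.add_mem e1 e2) e3) e4) e4

end Summit.KontsevichZagierPeriods.LinRedNormalForm.WheelThreeSpokes
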